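import Mathlib.Analysis.InnerProductSpace.Calculus
import Mathlib.Analysis.Calculus.Deriv.Add
import Mathlib.Analysis.Calculus.Deriv.Mul
import Mathlib.Analysis.Calculus.FDeriv.Prod
import Mathlib.Analysis.Calculus.ContDiff.Basic
import Mathlib.LinearAlgebra.FiniteDimensional.Basic
import Mathlib.Topology.Algebra.Module.FiniteDimension
import HarnessLib

/-!
# The flattening zone of the tube stage: blending the tangential part to the identity

Topic `Literature/Topology/FourManifolds`; Euclidean analysis in `E × F` (codimension `≥ 2` steps
of the smoothing of PD homeomorphisms: Munkres, Ann. of Math. 72 (1960), §§4–5;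
Campbell–D'Onofrio–Vítek, J. Geom. Anal. (2026), Lemma 3.2 Step 2 "flatten images of hyperplane
pieces onto hyperplane pieces": `g = (1 - η)((0,0,λx₃) + π₃ ∘ g̃) + η g̃`).  For a stage map
`u = (T, N) : E × F → E × F` (tangential part `T`, normal part `N`) and a radial cutoff
`η : ℝ → ℝ` (`= 1` outside, `= 0` inside), the **flattened map** keeps the normal part and blends
the tangential part to the base point:

  `flattenStageMap T N η (x, y) = (x + η ‖y‖ • (T (x, y) − x), N (x, y))`.

Where `η = 1` it is `u`, where `η = 0` it is `(x, N (x, y))` — exactly `x`-preserving, the form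
on which cone-ification, rounding and untwisting act (`TubeConeify.lean`, `TubeRound.lean`,
`TubeRadial.lean`).  We prove the identities, smoothness off the zero section, the derivative
(`hasFDerivAt_flattenMap`), and the **nondegeneracy** (`injective_fderiv_flattenStageMap`) under
the pointwise, inverse-free "flatten coupling" condition: if the kernel of `DN(p)` is a graph of
slope `≤ K` over `E` (`DN(p)(v,w) = 0 ⟹ ‖w‖ ≤ K‖v‖`), `‖D_xT − I‖ ≤ δ`, `‖D_yT‖ ≤ C`,
`‖T p − x‖ ≤ D`, `|η| ≤ 1` and `δ + (C + |η'(‖y‖)| D) K < 1`, then the derivative of the flattened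
stage map is injective (a Schur-complement estimate: a kernel vector `(v, w)` has `‖w‖ ≤ K‖v‖` and
`‖v‖ ≤ (δ + (C + |η'|D)K)‖v‖`).  Definitions are explicit functions; no named facts.

## References

* J. R. Munkres, *Obstructions to the smoothing of piecewise-differentiable homeomorphisms*, Ann.
  of Math. (2) 72 (1960), 521–554, §§4–5. [Munkres1960]
* D. Campbell, L. D'Onofrio, T. Vítek, *Diffeomorphic approximation of piecewise affine
  homeomorphisms*, J. Geom. Anal. 36 (2026), Lemma 3.2 (Step 2). [CampbellDonofrioVitek2026]
-/

noncomputable section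

open Set Function Metric Filter
open scoped Topology ContDiff RealInnerProductSpace

namespace Literature.Topology.FourManifolds

variable {E : Type*} [NormedAddCommGroup E] [NormedSpace ℝ E]
variable {F : Type*} [NormedAddCommGroup F] [InnerProductSpace ℝ F]

/-- `∞ ≠ 0` in the smoothness exponents (bookkeeping). [folklore] -/
private theorem flatten_infty_ne_zero : (∞ : WithTop ℕ∞) ≠ 0 := by
  simp

omit [NormedAddCommGroup E] [NormedSpace ℝ E] in
/-- Derivative of the norm away from `0` (private copy of the tree's
`Literature.Analysis.Potential.HyperbolicBall.hasFDerivAt_norm_of_ne_zero`). [folklore] -/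
private theorem flatten_hasFDerivAt_norm {y : F} (hy : y ≠ 0) :
    HasFDerivAt (fun z : F => ‖z‖) (innerSL ℝ (‖y‖⁻¹ • y)) y := by
  have hy2 : ‖y‖ ^ 2 ≠ 0 := by positivity
  have h2 := (hasStrictFDerivAt_norm_sq y).hasFDerivAt.sqrt hy2
  have hfun : (fun z : F => ‖z‖) = fun z => Real.sqrt (‖z‖ ^ 2) := by
    funext z
    rw [Real.sqrt_sq (norm_nonneg z)]
  rw [hfun]
  refine h2.congr_fderiv (ContinuousLinearMap.ext fun v => ?_)
  rw [Real.sqrt_sq (norm_nonneg y)]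
  have hy0 : ‖y‖ ≠ 0 := norm_ne_zero_iff.2 hy
  simp only [innerSL_apply_apply, real_inner_smul_left]
  change (1 / (2 * ‖y‖)) • ((2 : ℕ) • innerSL ℝ y) v = ‖y‖⁻¹ * ⟪y, v⟫
  rw [two_nsmul]
  change (1 / (2 * ‖y‖)) * (⟪y, v⟫ + ⟪y, v⟫) = ‖y‖⁻¹ * ⟪y, v⟫
  field_simp
  ring

/-! ### The flattened map -/

/-- **The flattened tangential part** `flattenMap T η (x, y) = x + η ‖y‖ • (T (x, y) − x)`.
Campbell–D'Onofrio–Vítek (2026), Lemma 3.2 Step 2. [cite: CampbellDonofrioVitek2026, Lemma 3.2 (Step 2)] -/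
def flattenMap (T : E × F → E) (η : ℝ → ℝ) (p : E × F) : E :=
  p.1 + η ‖p.2‖ • (T p - p.1)

/-- **The flattened stage map** `(flattenMap T η p, N p)`: the normal part is untouched.
[cite: CampbellDonofrioVitek2026, Lemma 3.2 (Step 2)] -/
def flattenStageMap (T : E × F → E) (N : E × F → F) (η : ℝ → ℝ) (p : E × F) : E × F :=
  (flattenMap T η p, N p)

variable {T : E × F → E} {N : E × F → F} {η : ℝ → ℝ} {p : E × F}

omit [InnerProductSpace ℝ F] in
/-- The normal part of the flattened stage map is `N`. [folklore] -/
@[simp]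
theorem flattenStageMap_snd (p : E × F) : (flattenStageMap T N η p).2 = N p := rfl

omit [InnerProductSpace ℝ F] in
/-- The tangential part of the flattened stage map. [folklore] -/
@[simp]
theorem flattenStageMap_fst (p : E × F) : (flattenStageMap T N η p).1 = flattenMap T η p := rfl

omit [InnerProductSpace ℝ F] in
/-- **Outside (`η = 1`) flattening does nothing**: the stage map is `(T p, N p)`. [folklore] -/
theorem flattenStageMap_of_eta_eq_one (h : η ‖p.2‖ = 1) : flattenStageMap T N η p = (T p, N p) := by
  rw [flattenStageMap, flattenMap, h, one_smul, add_sub_cancel]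

omit [InnerProductSpace ℝ F] in
/-- **Inside (`η = 0`) the flattened stage map is `x`-preserving**: `(x, N (x, y))`. [folklore] -/
theorem flattenStageMap_of_eta_eq_zero (h : η ‖p.2‖ = 0) : flattenStageMap T N η p = (p.1, N p) := by
  rw [flattenStageMap, flattenMap, h, zero_smul, add_zero]

omit [InnerProductSpace ℝ F] in
/-- The flattened tangential part displaces by at most `|η| ‖T p − x‖`. [folklore] -/
theorem norm_flattenMap_sub_fst (p : E × F) : ‖flattenMap T η p - p.1‖ = |η ‖p.2‖| * ‖T p - p.1‖ := by
  rw [flattenMap, add_sub_cancel_left, norm_smul, Real.norm_eq_abs]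

/-- **Smoothness of the flattened map off the zero section.** [folklore] -/
theorem contDiffAt_flattenMap (hp : p.2 ≠ 0) (hT : ContDiffAt ℝ ∞ T p) (hη : ContDiffAt ℝ ∞ η ‖p.2‖) :
    ContDiffAt ℝ ∞ (flattenMap T η) p := by
  have hn : ContDiffAt ℝ ∞ (fun q : E × F => ‖q.2‖) p := (contDiffAt_norm ℝ hp).comp p contDiffAt_snd
  exact contDiffAt_fst.add ((hη.comp p hn).smul (hT.sub contDiffAt_fst))

/-- Smoothness of the flattened stage map off the zero section. [folklore] -/
theorem contDiffAt_flattenStageMap (hp : p.2 ≠ 0) (hT : ContDiffAt ℝ ∞ T p) (hN : ContDiffAt ℝ ∞ N p)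
    (hη : ContDiffAt ℝ ∞ η ‖p.2‖) : ContDiffAt ℝ ∞ (flattenStageMap T N η) p :=
  (contDiffAt_flattenMap hp hT hη).prodMk hN

omit [InnerProductSpace ℝ F] in
/-- **Where the cutoff vanishes identically near `‖y‖`, the flattened map is locally the first
projection** — in particular smooth, also when `T` is not. [folklore] -/
theorem flattenMap_eventuallyEq_fst {t₀ : ℝ} (hη0 : ∀ t ≤ t₀, η t = 0) (hpt : ‖p.2‖ < t₀) :
    flattenMap T η =ᶠ[𝓝 p] fun q => q.1 := by
  have ho : IsOpen {q : E × F | ‖q.2‖ < t₀} := isOpen_lt (continuous_norm.comp continuous_snd) continuous_const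
  filter_upwards [ho.mem_nhds hpt] with q hq
  rw [flattenMap, hη0 _ (le_of_lt hq), zero_smul, add_zero]

/-- **The derivative of the flattened map** off the zero section:
`D(flattenMap)(p) = fst + η(t) • (DT(p) − fst) + (η'(t) ⟪ŷ, ·⟫ ∘ snd) ⊗ (T p − x)`, `t = ‖y‖`.
[folklore] -/
theorem hasFDerivAt_flattenMap (hp : p.2 ≠ 0) (hT : DifferentiableAt ℝ T p) {η' : ℝ}
    (hη : HasDerivAt η η' ‖p.2‖) :
    HasFDerivAt (flattenMap T η)
      (ContinuousLinearMap.fst ℝ E F +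
        (η ‖p.2‖ • (fderiv ℝ T p - ContinuousLinearMap.fst ℝ E F) +
          (η' • (innerSL ℝ (‖p.2‖⁻¹ • p.2)).comp (ContinuousLinearMap.snd ℝ E F)).smulRight
            (T p - p.1))) p := by
  have hn : HasFDerivAt (fun q : E × F => ‖q.2‖)
      ((innerSL ℝ (‖p.2‖⁻¹ • p.2)).comp (ContinuousLinearMap.snd ℝ E F)) p :=
    (flatten_hasFDerivAt_norm hp).comp p hasFDerivAt_snd
  have hηp : HasFDerivAt (fun q : E × F => η ‖q.2‖)
      (η' • (innerSL ℝ (‖p.2‖⁻¹ • p.2)).comp (ContinuousLinearMap.snd ℝ E F)) p :=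
    hη.comp_hasFDerivAt p hn
  have hTs : HasFDerivAt (fun q : E × F => T q - q.1) (fderiv ℝ T p - ContinuousLinearMap.fst ℝ E F) p :=
    hT.hasFDerivAt.sub hasFDerivAt_fst
  exact hasFDerivAt_fst.add (hηp.smul hTs)

/-- **Nondegeneracy of flattening** (pointwise, inverse-free Schur-complement criterion). Let
`p = (x, y)`, `y ≠ 0`, `T`, `N` differentiable at `p`, `η` differentiable at `t = ‖y‖`, and
assume: the kernel of `DN(p)` is a graph of slope at most `K` over `E`
(`DN(p)(v, w) = 0 ⟹ ‖w‖ ≤ K ‖v‖`); `‖DT(p)(v,0) − v‖ ≤ δ‖v‖`; `‖DT(p)(0,w)‖ ≤ C‖w‖`;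
`‖T p − x‖ ≤ D`; `|η t| ≤ 1`; and the **flatten coupling is small**:
`δ + (C + |η'(t)| D) K < 1`.  Then the derivative of the flattened stage map at `p` is injective:
a kernel vector `(v, w)` has `DN(p)(v,w) = 0`, so `‖w‖ ≤ K‖v‖`, and the tangential equation
`v + η (DT(v,w) − v) + η'⟪ŷ,w⟫ (T p − x) = 0` gives `‖v‖ ≤ (δ + (C + |η'| D) K) ‖v‖`, whence
`v = 0` and `w = 0`.  (In the smoothing induction `K` comes from the a-priori conditioning of the
normal part and `δ, C·K, D` are small/bounded at scale `r`; inside zones of higher stages the map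
is exactly `x`-preserving, `T = fst`, and the condition is trivially met with `δ = C = 0`.)
Campbell–D'Onofrio–Vítek (2026), Lemma 3.2 Step 2. [cite: CampbellDonofrioVitek2026, Lemma 3.2 (Step 2)] -/
theorem injective_fderiv_flattenStageMap (hp : p.2 ≠ 0) (hT : DifferentiableAt ℝ T p)
    (hN : DifferentiableAt ℝ N p) {η' : ℝ} (hη : HasDerivAt η η' ‖p.2‖) {K δ C D : ℝ}
    (hC : 0 ≤ C)
    (hker : ∀ (v : E) (w : F), fderiv ℝ N p (v, w) = 0 → ‖w‖ ≤ K * ‖v‖)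
    (hTx : ∀ v : E, ‖fderiv ℝ T p (v, 0) - v‖ ≤ δ * ‖v‖)
    (hTy : ∀ w : F, ‖fderiv ℝ T p (0, w)‖ ≤ C * ‖w‖) (hD : ‖T p - p.1‖ ≤ D)
    (hη1 : |η ‖p.2‖| ≤ 1) (hsmall : δ + (C + |η'| * D) * K < 1) :
    Injective (fderiv ℝ (flattenStageMap T N η) p) := by
  have hflat := hasFDerivAt_flattenMap hp hT hη
  have hΦ : HasFDerivAt (flattenStageMap T N η) ((ContinuousLinearMap.fst ℝ E F +
      (η ‖p.2‖ • (fderiv ℝ T p - ContinuousLinearMap.fst ℝ E F) +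
        (η' • (innerSL ℝ (‖p.2‖⁻¹ • p.2)).comp (ContinuousLinearMap.snd ℝ E F)).smulRight
          (T p - p.1))).prod (fderiv ℝ N p)) p :=
    hflat.prodMk hN.hasFDerivAt
  rw [hΦ.fderiv]
  refine (injective_iff_map_eq_zero _).2 fun vw h => ?_
  obtain ⟨v, w⟩ := vw
  have h1 := congrArg Prod.fst h
  have h2 := congrArg Prod.snd h
  simp only [ContinuousLinearMap.prod_apply, Prod.snd_zero] at h2
  -- the normal equation: `‖w‖ ≤ K ‖v‖`
  have hwK : ‖w‖ ≤ K * ‖v‖ := hker v w h2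
  -- the tangential equation
  simp only [ContinuousLinearMap.prod_apply, Prod.fst_zero] at h1
  change v + ((η ‖p.2‖) • (fderiv ℝ T p (v, w) - ((v, w) : E × F).1) +
      (η' • ⟪‖p.2‖⁻¹ • p.2, ((v, w) : E × F).2⟫) • (T p - p.1)) = 0 at h1
  simp only at h1
  -- split `DT (v, w) = DT (v, 0) + DT (0, w)`
  have hsplit : fderiv ℝ T p (v, w) = fderiv ℝ T p (v, 0) + fderiv ℝ T p (0, w) := by
    rw [← map_add]; congr 1; ext <;> simp
  rw [hsplit] at h1
  have hv_eq : v = -((η ‖p.2‖) • (fderiv ℝ T p (v, 0) + fderiv ℝ T p (0, w) - v) +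
      (η' • ⟪‖p.2‖⁻¹ • p.2, w⟫) • (T p - p.1)) := eq_neg_of_add_eq_zero_left h1
  have ha : |⟪‖p.2‖⁻¹ • p.2, w⟫| ≤ ‖w‖ := by
    have h := abs_real_inner_le_norm (‖p.2‖⁻¹ • p.2) w
    rwa [norm_smul, norm_inv, norm_norm, inv_mul_cancel₀ (norm_ne_zero_iff.2 hp), one_mul] at h
  have hD0 : 0 ≤ D := (norm_nonneg _).trans hD
  -- the two pieces of the tangential equation
  have e1 : ‖(η ‖p.2‖) • (fderiv ℝ T p (v, 0) + fderiv ℝ T p (0, w) - v)‖ ≤ δ * ‖v‖ + C * ‖w‖ := by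
    rw [norm_smul, Real.norm_eq_abs]
    have hin : ‖fderiv ℝ T p (v, 0) + fderiv ℝ T p (0, w) - v‖ ≤ δ * ‖v‖ + C * ‖w‖ := by
      calc ‖fderiv ℝ T p (v, 0) + fderiv ℝ T p (0, w) - v‖
          = ‖(fderiv ℝ T p (v, 0) - v) + fderiv ℝ T p (0, w)‖ := by abel_nf
        _ ≤ ‖fderiv ℝ T p (v, 0) - v‖ + ‖fderiv ℝ T p (0, w)‖ := norm_add_le _ _
        _ ≤ δ * ‖v‖ + C * ‖w‖ := add_le_add (hTx v) (hTy w)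
    calc |η ‖p.2‖| * ‖fderiv ℝ T p (v, 0) + fderiv ℝ T p (0, w) - v‖
        ≤ 1 * ‖fderiv ℝ T p (v, 0) + fderiv ℝ T p (0, w) - v‖ :=
          mul_le_mul_of_nonneg_right hη1 (norm_nonneg _)
      _ ≤ δ * ‖v‖ + C * ‖w‖ := by rw [one_mul]; exact hin
  have e2 : ‖(η' • ⟪‖p.2‖⁻¹ • p.2, w⟫) • (T p - p.1)‖ ≤ |η'| * ‖w‖ * D := by
    rw [norm_smul, smul_eq_mul, Real.norm_eq_abs, abs_mul]
    have : |η'| * |⟪‖p.2‖⁻¹ • p.2, w⟫| ≤ |η'| * ‖w‖ := mul_le_mul_of_nonneg_left ha (abs_nonneg _)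
    exact mul_le_mul this hD (norm_nonneg _) (by positivity)
  have hest : ‖v‖ ≤ (δ + (C + |η'| * D) * K) * ‖v‖ := by
    calc ‖v‖ = ‖(η ‖p.2‖) • (fderiv ℝ T p (v, 0) + fderiv ℝ T p (0, w) - v) +
          (η' • ⟪‖p.2‖⁻¹ • p.2, w⟫) • (T p - p.1)‖ := by
            conv_lhs => rw [hv_eq]
            rw [norm_neg]
      _ ≤ δ * ‖v‖ + C * ‖w‖ + |η'| * ‖w‖ * D := (norm_add_le _ _).trans (add_le_add e1 e2)
      _ ≤ δ * ‖v‖ + C * (K * ‖v‖) + |η'| * (K * ‖v‖) * D := by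
            have h3 : C * ‖w‖ ≤ C * (K * ‖v‖) := mul_le_mul_of_nonneg_left hwK hC
            have h4 : |η'| * ‖w‖ * D ≤ |η'| * (K * ‖v‖) * D :=
              mul_le_mul_of_nonneg_right (mul_le_mul_of_nonneg_left hwK (abs_nonneg _)) hD0
            linarith
      _ = (δ + (C + |η'| * D) * K) * ‖v‖ := by ring
  -- conclude `v = 0`, then `w = 0`
  have hv0 : v = 0 := by
    by_contra hv
    have hvpos : 0 < ‖v‖ := norm_pos_iff.2 hv
    have h3 : (1 : ℝ) * ‖v‖ ≤ (δ + (C + |η'| * D) * K) * ‖v‖ := by rw [one_mul]; exact hest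
    have h4 := le_of_mul_le_mul_right h3 hvpos
    linarith
  have hw0 : w = 0 := by
    have : ‖w‖ ≤ 0 := by rw [hv0, norm_zero, mul_zero] at hwK; exact hwK
    exact norm_le_zero_iff.1 this
  rw [hv0, hw0]
  rfl

/-- Packaged form for the inverse function theorem (finite-dimensional `E`, `F`): under the
hypotheses of `injective_fderiv_flattenStageMap`, with `T`, `N`, `η` smooth, the derivative of
the flattened stage map is a linear isomorphism. [folklore] -/
theorem exists_hasFDerivAt_equiv_flattenStageMap [FiniteDimensional ℝ E] [FiniteDimensional ℝ F]
    (hp : p.2 ≠ 0) (hT : ContDiffAt ℝ ∞ T p) (hN : ContDiffAt ℝ ∞ N p) (hη : ContDiffAt ℝ ∞ η ‖p.2‖)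
    {K δ C D : ℝ} (hC : 0 ≤ C)
    (hker : ∀ (v : E) (w : F), fderiv ℝ N p (v, w) = 0 → ‖w‖ ≤ K * ‖v‖)
    (hTx : ∀ v : E, ‖fderiv ℝ T p (v, 0) - v‖ ≤ δ * ‖v‖)
    (hTy : ∀ w : F, ‖fderiv ℝ T p (0, w)‖ ≤ C * ‖w‖) (hD : ‖T p - p.1‖ ≤ D)
    (hη1 : |η ‖p.2‖| ≤ 1) (hsmall : δ + (C + |deriv η ‖p.2‖| * D) * K < 1) :
    ∃ L : (E × F) ≃L[ℝ] E × F,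
      HasFDerivAt (flattenStageMap T N η) (L : E × F →L[ℝ] E × F) p := by
  have hd : DifferentiableAt ℝ (flattenStageMap T N η) p :=
    (contDiffAt_flattenStageMap hp hT hN hη).differentiableAt flatten_infty_ne_zero
  have hinj := injective_fderiv_flattenStageMap hp (hT.differentiableAt flatten_infty_ne_zero)
    (hN.differentiableAt flatten_infty_ne_zero)
    ((hη.differentiableAt flatten_infty_ne_zero).hasDerivAt) hC hker hTx hTy hD hη1 hsmall
  let L : (E × F) ≃L[ℝ] E × F :=
    LinearEquiv.toContinuousLinearEquiv
      (LinearEquiv.ofInjectiveEndo (fderiv ℝ (flattenStageMap T N η) p).toLinearMap hinj)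
  refine ⟨L, ?_⟩
  have hcoe : (L : E × F →L[ℝ] E × F) = fderiv ℝ (flattenStageMap T N η) p :=
    ContinuousLinearMap.ext fun v => rfl
  rw [hcoe]
  exact hd.hasFDerivAt

end Literature.Topology.FourManifolds
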